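import Summits.CriticalPhenomena.SAWScalingLimit.Theses.SAWRestrictionRigidity
import Summits.CriticalPhenomena.CardyFormulaZ2.Theorems.SymmetryUpgradeR.Negative.DiracChords

/-!
# The remaining domain remembers the base domain (line `registered`, lead c3), crux `Rigidity` (stmt-CriticalPhenomena-1368)

Target: `Summits/CriticalPhenomena/SAWScalingLimit/Theorems/SAWRestrictionRigidityRigidityRemainingDomainBase.lean`
(`--supports stmt-CriticalPhenomena-1368`, registered sub-goal `carrier_eq_of_remainingDomain_eq`).

Kernel-checked form of §0 of the crux idea `Ideas/texture-keyed-modulus.md`: a Jordan domain is REGULAR OPEN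
(`interior (closure D) = D` — reused from the percolation sibling's negative file
`CardyFormulaZ2/Theorems/SymmetryUpgradeR/Negative/DiracChords.lean`, `JordanDomain.interior_closure_carrier`), hence
any dense open part `Ω ⊆ D` — in particular the remaining domain `remainingDomain D p` after a slit-like explored past —
determines the carrier as `interior (closure Ω)`. Consequently the clause `domain` of `ChordalFamily.IsMarkovExtension`
("`Q D p` depends only on `(remainingDomain D p, p.target, D.pt 1)`") does NOT prevent the Markov kernel from depending
on the base domain `D.carrier`: two explored configurations with the same (dense) remaining domain have the same carrier.
-/

namespace Summit.CriticalPhenomena.SAWScalingLimit.Cruxes.Rigidity.Cocycle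

open Set
open Literature.Probability.RandomPlanarGeometry

/-- A dense open part of a Jordan domain determines the domain: if `Ω ⊆ D ⊆ closure Ω` then
`interior (closure Ω) = D`. [folklore] -/
theorem interior_closure_eq_carrier_of_dense (D : JordanDomain) {Ω : Set ℂ} (hΩ : Ω ⊆ D.carrier)
    (hd : D.carrier ⊆ closure Ω) : interior (closure Ω) = D.carrier := by
  have hcl : closure Ω = closure D.carrier :=
    (closure_mono hΩ).antisymm (closure_minimal hd isClosed_closure)
  rw [hcl, Summit.CriticalPhenomena.CardyFormulaZ2.Theorems.SymmetryUpgradeR.Negative.JordanDomain.interior_closure_carrier]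

/-- **The remaining domain remembers the base domain.** If two explored configurations `(D₁, p₁)`, `(D₂, p₂)` of
Dobrushin domains have the same remaining domain, and each remaining domain is dense in its carrier (the case of a
slit-like past: a simple arc from the first marked point), then the carriers agree — so a Markov kernel that is a
function of `(remainingDomain D p, p.target, D.pt 1)`, as clause `domain` of `ChordalFamily.IsMarkovExtension` demands,
may still depend on `D.carrier`. [folklore] -/
theorem carrier_eq_of_remainingDomain_eq : ∀ (D₁ D₂ : Literature.Probability.RandomPlanarGeometry.DobrushinDomain) (p₁ p₂ : Literature.Probability.RandomPlanarGeometry.CurveClass ℂ), Literature.Probability.RandomPlanarGeometry.remainingDomain D₁ p₁ = Literature.Probability.RandomPlanarGeometry.remainingDomain D₂ p₂ → D₁.carrier ⊆ closure (Literature.Probability.RandomPlanarGeometry.remainingDomain D₁ p₁) → D₂.carrier ⊆ closure (Literature.Probability.RandomPlanarGeometry.remainingDomain D₂ p₂) → D₁.carrier = D₂.carrier := by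
  intro D₁ D₂ p₁ p₂ h h₁ h₂
  have e₁ := interior_closure_eq_carrier_of_dense D₁.toJordanDomain
    (fun z hz => ((remainingDomain_subset D₁ p₁) hz).1) h₁
  have e₂ := interior_closure_eq_carrier_of_dense D₂.toJordanDomain
    (fun z hz => ((remainingDomain_subset D₂ p₂) hz).1) h₂
  rw [← e₁, ← e₂, h]

end Summit.CriticalPhenomena.SAWScalingLimit.Cruxes.Rigidity.Cocycle
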